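import Summits.QuantumFields.YangMills.Theorems.FluctuationComparisonRegPrIntLS2BetaSchurTest
import HarnessLib

/-!
# S2β · `hFlat` road, brick (G11) of UV3-NODE §64.2 — THE KEY LEMMA SKELETON: from the POINTWISE level inequality
# `f_{t+1} ≤ (1+θ_t)·T_t f_t + j_t` (positive kernel `T_t` with row sums `≤ R_t`, column sums `≤ C_t`) and the junk budget `‖j_t‖₂ ≤ ε_t‖f_t‖₂` to
# `‖f_t‖₂ ≤ Π_{i<t}((1+θ_i)√(R_iC_i) + ε_i)·‖f_0‖₂` — Minkowski + Schur + the product recursion, over an arbitrary level-indexed family of finite types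

Cell `ym3-torus` (rung R3 = continuum `SU(2)` Yang–Mills on the three-torus — NOT d = 4, NOT infinite volume, NOT a mass gap, NOT Clay).
Width seat «width 8» `ym3-torus-px8` (gen 21), FREE px helper on crux `stmt-QuantumFields-20520`, count-neutral, DEFINITION-FREE, Mathlib-only (+ ✓`…SchurTest`).

WHY (UV3-NODE §64.2, last lines).  The (C)-assembler proves, level by level on the `Setup` torus, the pointwise inequality with `f_t = dist1` of the level-`t`
plaquette holonomies, `T_t` the tent kernel (✓px12 `…TentKernelTorus`: `R = L²`, `C = L⁻¹` at `d = 3`), `θ_t` the `dist1 ↔ log` conversion, `j_t` the hybrid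
(✓`…HybridFourSlot`) + coupling (✓`…CouplingCost`) junk with `ε_t = C(L)·θ_{t−1}`; this file turns that into the KEY LEMMA `‖f_t‖₂ ≤ K·L^{t∕2}‖f_0‖₂` in ONE `exact`.
* §1 `sqrt_sum_sq_add_le` (Minkowski, `p = 2`, finite sums), `sqrt_sum_sq_le_of_le_add` (monotone version for `0 ≤ f ≤ x + y`).
* §2 ★★ `keyLemma_level` — one level: `‖f′‖₂ ≤ ((1+θ)√(RC) + ε)·‖f‖₂`.
* §3 ★★★ `keyLemma_tower` — the tower over `α : ℕ → Type*`: `‖f t‖₂ ≤ (Π_{i<t}((1+θ i)√(R i·C i) + ε i))·‖f 0‖₂`; `keyLemma_tower_sqrtL` — the reading with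
  `R i·C i = L`: `‖f t‖₂ ≤ (√L)^t·exp(Σ_{i<t}(θ i + ε i∕√L))·‖f 0‖₂` (`1 ≤ L`).

HONEST SCOPE.  Finite sums, Cauchy–Schwarz, products; nothing of Bałaban's analysis; the pointwise level inequality on the torus (lasso Stokes + hybrid + coupling),
the KEY LEMMA's use in (H) of ✓px17 `…HFlatOfRelativeLetter`, `hFlat`, TUBE-REG∘, GAP♯∘, S2β, crux 20520 and `YM3TorusSU2` are NOT proved; no registered stub is closed;
the Yang–Mills mass gap is NOT proved.  References: T. Bałaban, CMP **99** (1985) [Balaban1985RegularSpaces]; CMP **96** (1984) [Balaban1984PropagatorsII].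
-/

set_option autoImplicit false

noncomputable section

open Finset
open scoped BigOperators

namespace Summit.QuantumFields.YangMills.Theorems.FluctuationComparisonRegPrIntLS2BetaKeyLemmaSkeleton

open Summit.QuantumFields.YangMills.Theorems.FluctuationComparisonRegPrIntLS2BetaSchurTest (schur_test_sq le_prod_mul_of_forall_le_mul)

/-! ## §1 Minkowski for finite sums (`p = 2`) -/

/-- **MINKOWSKI (`p = 2`, finite sums)**: `√(Σ (x+y)²) ≤ √(Σ x²) + √(Σ y²)`. [folklore] -/
theorem sqrt_sum_sq_add_le {α : Type*} (s : Finset α) (x y : α → ℝ) :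
    √(∑ a ∈ s, (x a + y a) ^ 2) ≤ √(∑ a ∈ s, x a ^ 2) + √(∑ a ∈ s, y a ^ 2) := by
  have hX := Real.sqrt_nonneg (∑ a ∈ s, x a ^ 2)
  have hY := Real.sqrt_nonneg (∑ a ∈ s, y a ^ 2)
  have hCS := Real.sum_mul_le_sqrt_mul_sqrt s x y
  rw [Real.sqrt_le_left (by positivity)]
  have e : ∑ a ∈ s, (x a + y a) ^ 2 = ∑ a ∈ s, x a ^ 2 + 2 * ∑ a ∈ s, x a * y a + ∑ a ∈ s, y a ^ 2 := by
    rw [Finset.mul_sum, ← Finset.sum_add_distrib, ← Finset.sum_add_distrib]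
    exact Finset.sum_congr rfl fun a _ => by ring
  rw [e, add_sq, Real.sq_sqrt (Finset.sum_nonneg fun _ _ => sq_nonneg _), Real.sq_sqrt (Finset.sum_nonneg fun _ _ => sq_nonneg _)]
  nlinarith

/-- `0 ≤ f ≤ x + y` pointwise ⟹ `√(Σ f²) ≤ √(Σ x²) + √(Σ y²)`. [folklore] -/
theorem sqrt_sum_sq_le_of_le_add {α : Type*} (s : Finset α) (f x y : α → ℝ) (hf : ∀ a ∈ s, 0 ≤ f a) (h : ∀ a ∈ s, f a ≤ x a + y a) :
    √(∑ a ∈ s, f a ^ 2) ≤ √(∑ a ∈ s, x a ^ 2) + √(∑ a ∈ s, y a ^ 2) := by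
  refine (Real.sqrt_le_sqrt (Finset.sum_le_sum fun a ha => ?_)).trans (sqrt_sum_sq_add_le s x y)
  exact pow_le_pow_left₀ (hf a ha) (h a ha) 2

/-! ## §2 One level -/

/-- ★★ **ONE LEVEL OF THE KEY LEMMA**: `K ≥ 0` with row sums `≤ R` (`0 ≤ R`) and column sums `≤ C`; `0 ≤ f`, `0 ≤ f′`, `0 ≤ θ`; pointwise
`f′ a ≤ (1+θ)·Σ_b K a b·f b + j a`; junk budget `√(Σ j²) ≤ ε·√(Σ f²)`. Then `√(Σ_a f′ a²) ≤ ((1+θ)·√(R·C) + ε)·√(Σ_b f b²)`. [folklore] -/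
theorem keyLemma_level {α β : Type*} [Fintype α] [Fintype β] (K : α → β → ℝ) (hK : ∀ a b, 0 ≤ K a b) {R C : ℝ} (hR : 0 ≤ R)
    (hrow : ∀ a, ∑ b, K a b ≤ R) (hcol : ∀ b, ∑ a, K a b ≤ C) (f : β → ℝ) (f' j : α → ℝ) (hf' : ∀ a, 0 ≤ f' a)
    {θ ε : ℝ} (hθ : 0 ≤ θ) (hstep : ∀ a, f' a ≤ (1 + θ) * ∑ b, K a b * f b + j a)
    (hj : √(∑ a, j a ^ 2) ≤ ε * √(∑ b, f b ^ 2)) :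
    √(∑ a, f' a ^ 2) ≤ ((1 + θ) * √(R * C) + ε) * √(∑ b, f b ^ 2) := by
  have hM := sqrt_sum_sq_le_of_le_add Finset.univ f' (fun a => (1 + θ) * ∑ b, K a b * f b) j (fun a _ => hf' a) (fun a _ => hstep a)
  have hS := schur_test_sq Finset.univ Finset.univ K (fun a _ b _ => hK a b) hR (fun a _ => hrow a) (fun b _ => hcol b) f
  have hT : √(∑ a, ((1 + θ) * ∑ b, K a b * f b) ^ 2) ≤ (1 + θ) * √(R * C) * √(∑ b, f b ^ 2) := by
    have e : ∑ a, ((1 + θ) * ∑ b, K a b * f b) ^ 2 = (1 + θ) ^ 2 * ∑ a, (∑ b, K a b * f b) ^ 2 := by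
      rw [Finset.mul_sum]; exact Finset.sum_congr rfl fun a _ => by ring
    rw [e, Real.sqrt_mul (sq_nonneg _), Real.sqrt_sq (by linarith), mul_assoc,
      ← Real.sqrt_mul' _ (Finset.sum_nonneg fun _ _ => sq_nonneg _)]
    gcongr
  calc √(∑ a, f' a ^ 2) ≤ √(∑ a, ((1 + θ) * ∑ b, K a b * f b) ^ 2) + √(∑ a, j a ^ 2) := hM
    _ ≤ (1 + θ) * √(R * C) * √(∑ b, f b ^ 2) + ε * √(∑ b, f b ^ 2) := add_le_add hT hj
    _ = ((1 + θ) * √(R * C) + ε) * √(∑ b, f b ^ 2) := by ring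

/-! ## §3 The tower -/

/-- ★★★ **THE KEY LEMMA SKELETON (tower)**: levels `α t` (finite), `0 ≤ f t`, kernels `K t ≥ 0` from level `t` to level `t+1` with row sums `≤ R t` (`0 ≤ R t`) and
column sums `≤ C t`, conversions `0 ≤ θ t`, junk `j t` with `√(Σ (j t)²) ≤ ε t·√(Σ (f t)²)`, `0 ≤ ε t`, and the pointwise level inequality
`f (t+1) a ≤ (1 + θ t)·Σ_b K t a b·f t b + j t a`. Then `√(Σ_a (f t a)²) ≤ (Π_{i<t} ((1+θ i)·√(R i·C i) + ε i))·√(Σ_b (f 0 b)²)` for every `t`.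
[cite: Balaban1985RegularSpaces, §1; Balaban1984PropagatorsII, §1] -/
theorem keyLemma_tower (α : ℕ → Type*) [∀ t, Fintype (α t)] (f : (t : ℕ) → α t → ℝ) (hf : ∀ t a, 0 ≤ f t a)
    (K : (t : ℕ) → α (t + 1) → α t → ℝ) (hK : ∀ t a b, 0 ≤ K t a b) (R C θ ε : ℕ → ℝ) (hR : ∀ t, 0 ≤ R t)
    (hrow : ∀ t a, ∑ b, K t a b ≤ R t) (hcol : ∀ t b, ∑ a, K t a b ≤ C t) (hθ : ∀ t, 0 ≤ θ t) (hε : ∀ t, 0 ≤ ε t)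
    (j : (t : ℕ) → α (t + 1) → ℝ)
    (hstep : ∀ t a, f (t + 1) a ≤ (1 + θ t) * ∑ b, K t a b * f t b + j t a)
    (hj : ∀ t, √(∑ a, j t a ^ 2) ≤ ε t * √(∑ b, f t b ^ 2)) (t : ℕ) :
    √(∑ a, f t a ^ 2) ≤ (∏ i ∈ range t, ((1 + θ i) * √(R i * C i) + ε i)) * √(∑ b, f 0 b ^ 2) := by
  refine le_prod_mul_of_forall_le_mul (fun t => √(∑ a, f t a ^ 2)) (fun i => (1 + θ i) * √(R i * C i) + ε i)
    (fun i => by have := hθ i; have := hε i; positivity) (fun i => ?_) t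
  exact keyLemma_level (K i) (hK i) (hR i) (hrow i) (hcol i) (f i) (f (i + 1)) (j i) (hf (i + 1)) (hθ i) (hstep i) (hj i)

/-- The `√L` reading: if `R i·C i = L` (`0 ≤ L`) at every level then `Π_{i<t}((1+θ i)√L + ε i) ≤ (√L)^t·exp(Σ_{i<t}(θ i + ε i∕√L))` for `1 ≤ L`, so
`‖f t‖₂ ≤ (√L)^t·exp(Σ_{i<t}(θ i + ε i∕√L))·‖f 0‖₂` — the KEY LEMMA with a DEPTH-FREE constant as soon as `Σθ`, `Σε` are bounded. [folklore] -/
theorem keyLemma_tower_sqrtL (α : ℕ → Type*) [∀ t, Fintype (α t)] (f : (t : ℕ) → α t → ℝ) (hf : ∀ t a, 0 ≤ f t a)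
    (K : (t : ℕ) → α (t + 1) → α t → ℝ) (hK : ∀ t a b, 0 ≤ K t a b) {L : ℝ} (hL : 1 ≤ L) (R C θ ε : ℕ → ℝ) (hR : ∀ t, 0 ≤ R t)
    (hRC : ∀ t, R t * C t = L)
    (hrow : ∀ t a, ∑ b, K t a b ≤ R t) (hcol : ∀ t b, ∑ a, K t a b ≤ C t) (hθ : ∀ t, 0 ≤ θ t) (hε : ∀ t, 0 ≤ ε t)
    (j : (t : ℕ) → α (t + 1) → ℝ)
    (hstep : ∀ t a, f (t + 1) a ≤ (1 + θ t) * ∑ b, K t a b * f t b + j t a)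
    (hj : ∀ t, √(∑ a, j t a ^ 2) ≤ ε t * √(∑ b, f t b ^ 2)) (t : ℕ) :
    √(∑ a, f t a ^ 2) ≤ Real.sqrt L ^ t * Real.exp (∑ i ∈ range t, (θ i + ε i / Real.sqrt L)) * √(∑ b, f 0 b ^ 2) := by
  have h := keyLemma_tower α f hf K hK R C θ ε hR hrow hcol hθ hε j hstep hj t
  refine h.trans (mul_le_mul_of_nonneg_right ?_ (Real.sqrt_nonneg _))
  have hsL : 1 ≤ Real.sqrt L := by rw [← Real.sqrt_one]; exact Real.sqrt_le_sqrt hL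
  have hsL0 : 0 < Real.sqrt L := by linarith
  -- each factor: `(1+θ)√L + ε = √L·(1 + (θ + ε/√L)) ≤ √L·exp(θ + ε/√L)`
  have hfac : ∀ i, (1 + θ i) * √(R i * C i) + ε i ≤ Real.sqrt L * Real.exp (θ i + ε i / Real.sqrt L) := fun i => by
    rw [hRC i]
    have e : (1 + θ i) * Real.sqrt L + ε i = Real.sqrt L * (1 + (θ i + ε i / Real.sqrt L)) := by
      field_simp
      ring
    rw [e]
    exact mul_le_mul_of_nonneg_left (by linarith [Real.add_one_le_exp (θ i + ε i / Real.sqrt L)]) hsL0.le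
  calc ∏ i ∈ range t, ((1 + θ i) * √(R i * C i) + ε i) ≤ ∏ i ∈ range t, Real.sqrt L * Real.exp (θ i + ε i / Real.sqrt L) :=
        Finset.prod_le_prod (fun i _ => by have := hθ i; have := hε i; positivity) fun i _ => hfac i
    _ = Real.sqrt L ^ t * Real.exp (∑ i ∈ range t, (θ i + ε i / Real.sqrt L)) := by
        rw [Finset.prod_mul_distrib, Finset.prod_const, Finset.card_range, Real.exp_sum]

end Summit.QuantumFields.YangMills.Theorems.FluctuationComparisonRegPrIntLS2BetaKeyLemmaSkeleton

end
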